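import Summits.Ventures.PercRepro2.UnionRowK3NoCertLinksA
import Summits.Ventures.PercRepro2.UnionRowK3NoCertLinksB

/-!
# The six-monomial Farkas obstruction, III: no degree-3 avoidance-PA certificate for the k = 3 union row
(blind cell PercRepro2, mine-1 g43; chain `UnionRowK3NoCertDefs` → `UnionRowK3NoCertLinksA` + `UnionRowK3NoCertLinksB` → `UnionRowK3NoCert`)

`y` is nonnegative on every admissible generator (`y_col_nonneg`: the link form is nonnegative at every cell, the nine
support cells by `UnionRowK3NoCertLinksA` and `UnionRowK3NoCertLinksB`, the others trivially; down-closed generators by complementation inside the box)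
and on every nonnegative-coefficient cubic, while `y(V) = −1`; hence no identity `V = Σ λ·m_c·slack + R` exists
(`no_degree3_certificate`): the degree-3 avoidance-PA proof currency of the cell cannot prove the k = 3 union-row instance
`X = Y = {u,v}`, `A = {σ_w = S}`, `B = {σ_v = S}` — the obstruction of mine-1 g42 (MINE1-UNIONROW-K3.md §10) in the kernel.
-/

namespace Summit.Ventures.PercRepro2.UnionRowK3NoCert

open Finset

/-- the link form of every generator is nonnegative (up-closed case) -/
theorem LF_nonneg {B S₁ S₂ : Finset Cell} (hB : IsBox B) (h₁ : UpIn B S₁) (h₂ : UpIn B S₂) (c : Cell) :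
    0 ≤ LF c B S₁ S₂ := by
  rcases c with ⟨cu, cv, cw⟩
  fin_cases cu <;> fin_cases cv <;> fin_cases cw
  · exact LF_nonneg_TTT hB h₁ h₂
  · simp (config := { decide := true }) [LF, ind]
  · exact LF_nonneg_TTS hB h₁ h₂
  · exact LF_nonneg_TNT hB h₁ h₂
  · simp (config := { decide := true }) [LF, ind]
  · exact LF_nonneg_TNS hB h₁ h₂
  · simp (config := { decide := true }) [LF, ind]
  · simp (config := { decide := true }) [LF, ind]
  · exact LF_nonneg_TSS hB h₁ h₂
  · simp (config := { decide := true }) [LF, ind]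
  · simp (config := { decide := true }) [LF, ind]
  · simp (config := { decide := true }) [LF, ind]
  · simp (config := { decide := true }) [LF, ind]
  · simp (config := { decide := true }) [LF, ind]
  · simp (config := { decide := true }) [LF, ind]
  · simp (config := { decide := true }) [LF, ind]
  · simp (config := { decide := true }) [LF, ind]
  · simp (config := { decide := true }) [LF, ind]
  · exact LF_nonneg_STT hB h₁ h₂
  · simp (config := { decide := true }) [LF, ind]
  · simp (config := { decide := true }) [LF, ind]
  · simp (config := { decide := true }) [LF, ind]
  · simp (config := { decide := true }) [LF, ind]
  · exact LF_nonneg_SNS hB h₁ h₂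
  · exact LF_nonneg_SST hB h₁ h₂
  · simp (config := { decide := true }) [LF, ind]
  · exact LF_nonneg_SSS hB h₁ h₂

/-- `y` is nonnegative on every admissible generator -/
theorem y_col_nonneg (g : Gen) : 0 ≤ y (col g.c g.B g.S₁ g.S₂) := by
  rcases g with ⟨c, B, S₁, S₂, hB, hmono⟩
  rcases hmono with ⟨h₁, h₂⟩ | ⟨h₁, h₂⟩
  · rw [y_col_eq_LF h₁.1 h₂.1]
    exact LF_nonneg hB h₁ h₂ c
  · rw [y_col_eq_LF h₁.1 h₂.1, ← LF_compl c]
    exact LF_nonneg hB (upIn_sdiff h₁) (upIn_sdiff h₂) c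

/-- **The obstruction.**  The union-row form `V` of the instance `X = Y = {u,v}`, `A = {σ_w = S}`, `B = {σ_v = S}` is not
a nonnegative combination of generators `m_c · (M(S₁ ∩ S₂)·M(B) − M(S₁)·M(S₂))` plus a cubic with nonnegative coefficients,
as polynomials in the 27 cell masses: the degree-3 avoidance-PA currency cannot prove this k = 3 union-row instance. -/
theorem no_degree3_certificate :
    ¬ ∃ (n : ℕ) (lam : Fin n → ℚ) (g : Fin n → Gen) (Rm : Tensor),
      (∀ i, 0 ≤ lam i) ∧ (∀ a b c, 0 ≤ Rm a b c) ∧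
      sym V = sym (fun a b c => (∑ i, lam i * col (g i).c (g i).B (g i).S₁ (g i).S₂ a b c) + Rm a b c) := by
  rintro ⟨n, lam, g, Rm, hlam, hRm, hV⟩
  have h1 : y V = y (fun a b c => (∑ i, lam i * col (g i).c (g i).B (g i).S₁ (g i).S₂ a b c) + Rm a b c) := by
    unfold y; rw [hV]
  rw [y_V, y_add (fun a b c => ∑ i, lam i * col (g i).c (g i).B (g i).S₁ (g i).S₂ a b c) Rm,
    y_sum (fun i a b c => lam i * col (g i).c (g i).B (g i).S₁ (g i).S₂ a b c)] at h1
  simp only [y_smul] at h1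
  have hs : 0 ≤ ∑ i, lam i * y (col (g i).c (g i).B (g i).S₁ (g i).S₂) :=
    Finset.sum_nonneg fun i _ => mul_nonneg (hlam i) (y_col_nonneg (g i))
  have hr := y_nonneg_of_nonneg hRm
  linarith

end Summit.Ventures.PercRepro2.UnionRowK3NoCert
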